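import Literature.NumberTheory.Automorphic.Zelevinsky1980.DetCharInducingDatum
import Literature.RepresentationTheory.SeesawScalarCharacter
import Literature.LinearAlgebra.Matrix.GeneralLinearGroupAbelianization
import Literature.NumberTheory.Automorphic.Liu2021.LemD1LocalInjectivity
import HarnessLib

/-!
# Twisting a smooth induction by a character of the big group: `(θ ⊗ Ind_H^G σ) ≅ Ind_H^G (σ ⊗ θ|_H)`;
# `(θ₀∘det) ⊗ ((ν∘det) × χ′) ≅ ((νθ₀)∘det) × (χ′θ₀)`

Topic `NumberTheory/Automorphic` (smooth induction) with an application in `NumberTheory/Automorphic/Zelevinsky1980`; theorems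
only (no definition, no named fact).  Let `G` be a topological group, `H ≤ G`, `σ` a representation of `H` on `W` (any
commutative coefficient ring `k`) and `θ : G →* kˣ` a character with OPEN kernel.

* `SmoothInd.exists_linearEquiv_twist` — **`f ↦ θ · f` is a `k`-linear isomorphism `Ind_H^G σ ≃ Ind_H^G (σ ⊗ θ|_H)`
  (`Representation.SmoothInd`, `Representation.twist σ (θ.comp H.subtype)`) carrying the twisted action `θ(g) • Ind σ (g)`
  to `Ind (σ ⊗ θ|_H) (g)`** (the open kernel keeps `θ · f` smooth); packaged as
  `areIsomorphicRep_twist_smoothIndRep` : `SeesawScalar.twist θ (Ind_H^G σ) ≅ Ind_H^G (σ ⊗ θ|_H)` (`Liu2021.AreIsomorphicRep`).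
  (Bernstein–Zelevinsky 1977, 1.9 (e): `χ ⊗ i_{G,M}(ρ) ≅ i_{G,M}(χ|_M ⊗ ρ)` for a character `χ` of `G`.)
* characters of `GL_N(K)` through `det` (`GLAbelianization.existsUnique_eq_comp_det`): `exists_eq_comp_det_unitary_isOpen` —
  a character `θ` of `GL_N(K)` (`N ≥ 1`, `K` a topological field `≠ 𝔽₂`) is `θ₀ ∘ det` with `θ₀` UNITARY if `θ` is and with
  OPEN kernel if `θ` has;
* `Zelevinsky1980.detCharDatum_mul_det` — the inducing datum of `((νθ₀)∘det) × (χ′θ₀)` is that of `(ν∘det) × χ′` times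
  `θ₀(det p)` (`det p = det A · λ` for `p = ((A,*),(0,λ))`, Mathlib `Matrix.BlockTriangular.det_fintype`), whence
  `Zelevinsky1980.areIsomorphicRep_twist_det_parabolicIndGL_detChar` —
  **`(θ₀∘det) ⊗ ((ν∘det) × χ′) ≅ ((νθ₀)∘det) × (χ′θ₀)`** as representations of `GL_N(F)` (`F` non-archimedean local, `θ₀` with
  open kernel).  Consumer: cell hodgecm-mathlib, row IV-4c4 (a unitary twist `η∘det` of the split-place model of a rank-one theta
  lift is again a split-place model, with `ν` replaced by `νη`).

## References

* I. N. Bernstein, A. V. Zelevinsky, *Induced representations of reductive `p`-adic groups I*, Ann. Sci. ÉNS 10 (1977), 1.9,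
  Prop. 1.9 (e). [BernsteinZelevinskyASENS1977]
* A. V. Zelevinsky, *Induced representations of reductive `p`-adic groups II*, Ann. Sci. ÉNS 13 (1980), §1.1, Prop. 1.1 (`χ(det)`
  twists of `i(ρ)`). [Zelevinsky1980]
-/

noncomputable section

open Matrix Literature.LinearAlgebra.Matrix.DiagonalTorus

namespace Literature.NumberTheory.Automorphic

/-! ### `θ ⊗ Ind_H^G σ ≅ Ind_H^G (σ ⊗ θ|_H)` -/

section Twist

variable {k G W : Type*} [CommRing k] [Group G] [TopologicalSpace G] [IsTopologicalGroup G]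
  [AddCommGroup W] [Module k W] (H : Subgroup G) (σ : Representation k H W) (θ : G →* kˣ)

/-- The function `g ↦ θ(g) • f(g)` attached to `f ∈ Ind_H^G σ` is an element of `Ind_H^G (σ ⊗ θ|_H)` whenever `ker θ` is open:
existence with its defining formula. [cite: BernsteinZelevinskyASENS1977, 1.9] -/
theorem SmoothInd.exists_toFun_eq_smul_of_isOpen_ker (hθ : IsOpen ((θ.ker : Subgroup G) : Set G))
    (f : Representation.SmoothInd H σ) :
    ∃ F : Representation.SmoothInd H (σ.twist (θ.comp H.subtype)), ∀ g, F.toFun g = ((θ g : kˣ) : k) • f.toFun g := by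
  have hmem : (fun g : G => ((θ g : kˣ) : k) • f.toFun g) ∈ Representation.coindV H.subtype (σ.twist (θ.comp H.subtype)) := by
    refine (Representation.mem_indFun_iff H _ _).2 fun h g => ?_
    show ((θ ((h : G) * g) : kˣ) : k) • f.toFun ((h : G) * g) = (σ.twist (θ.comp H.subtype)) h (((θ g : kˣ) : k) • f.toFun g)
    rw [Representation.SmoothInd.toFun_subgroup_mul, Representation.twist_apply, MonoidHom.comp_apply, Subgroup.coe_subtype,
      map_smul, map_mul, Units.val_mul, mul_smul]
  refine ⟨⟨⟨fun g : G => ((θ g : kˣ) : k) • f.toFun g, hmem⟩, ?_⟩, fun g => rfl⟩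
  show (Representation.indFun H (σ.twist (θ.comp H.subtype))).IsSmoothVector _
  refine Subgroup.isOpen_mono (H₁ := (Representation.smoothIndRep H σ).stabilizerSubgroup f ⊓ θ.ker) (fun g hg => ?_)
    ((Representation.isSmooth_smoothInd H σ f).inter hθ)
  obtain ⟨hg₁, hg₂⟩ := Subgroup.mem_inf.1 hg
  rw [Representation.mem_stabilizerSubgroup] at hg₁ ⊢
  rw [MonoidHom.mem_ker] at hg₂
  refine Subtype.ext (funext fun x => ?_)
  rw [Representation.indFun_apply_apply]
  change ((θ (x * g) : kˣ) : k) • f.toFun (x * g) = ((θ x : kˣ) : k) • f.toFun x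
  have hx : f.toFun (x * g) = f.toFun x := by
    have := congrArg (fun F : Representation.SmoothInd H σ => F.toFun x) hg₁
    simpa only [Representation.toFun_smoothIndRep_apply] using this
  rw [map_mul, hg₂, mul_one, hx]

/-- **`θ ⊗ Ind_H^G σ ≅ Ind_H^G (σ ⊗ θ|_H)` by `f ↦ θ · f`.**  For a character `θ : G → kˣ` with open kernel there is a `k`-linear
isomorphism `e : Ind_H^G σ ≃ Ind_H^G (σ ⊗ θ|_H)` with `(e f)(g) = θ(g) f(g)`, carrying `θ(g₀) • (g₀ · f)` to `g₀ · (e f)`.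
[cite: BernsteinZelevinskyASENS1977, 1.9] -/
theorem SmoothInd.exists_linearEquiv_twist (hθ : IsOpen ((θ.ker : Subgroup G) : Set G)) :
    ∃ e : Representation.SmoothInd H σ ≃ₗ[k] Representation.SmoothInd H (σ.twist (θ.comp H.subtype)),
      (∀ (f : Representation.SmoothInd H σ) (g : G), (e f).toFun g = ((θ g : kˣ) : k) • f.toFun g) ∧
      ∀ (g₀ : G) (f : Representation.SmoothInd H σ),
        e (((θ g₀ : kˣ) : k) • Representation.smoothIndRep H σ g₀ f) =
          Representation.smoothIndRep H (σ.twist (θ.comp H.subtype)) g₀ (e f) := by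
  classical
  -- forward and backward maps
  choose Φ hΦ using SmoothInd.exists_toFun_eq_smul_of_isOpen_ker H σ θ hθ
  -- the inverse `F ↦ θ⁻¹ · F`, landing in `Ind σ`
  have hback : ∀ F : Representation.SmoothInd H (σ.twist (θ.comp H.subtype)),
      ∃ f : Representation.SmoothInd H σ, ∀ g, f.toFun g = (((θ g)⁻¹ : kˣ) : k) • F.toFun g := by
    intro F
    have hmem : (fun g : G => (((θ g)⁻¹ : kˣ) : k) • F.toFun g) ∈ Representation.coindV H.subtype σ := by
      refine (Representation.mem_indFun_iff H _ _).2 fun h g => ?_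
      show (((θ ((h : G) * g))⁻¹ : kˣ) : k) • F.toFun ((h : G) * g) = σ h ((((θ g)⁻¹ : kˣ) : k) • F.toFun g)
      rw [Representation.SmoothInd.toFun_subgroup_mul, Representation.twist_apply, MonoidHom.comp_apply, Subgroup.coe_subtype,
        map_smul, map_mul, mul_inv, Units.val_mul, smul_smul]
      congr 1
      rw [mul_comm, ← mul_assoc, Units.mul_inv, one_mul]
    refine ⟨⟨⟨fun g : G => (((θ g)⁻¹ : kˣ) : k) • F.toFun g, hmem⟩, ?_⟩, fun g => rfl⟩
    show (Representation.indFun H σ).IsSmoothVector _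
    refine Subgroup.isOpen_mono (H₁ := (Representation.smoothIndRep H _).stabilizerSubgroup F ⊓ θ.ker) (fun g hg => ?_)
      ((Representation.isSmooth_smoothInd H _ F).inter hθ)
    obtain ⟨hg₁, hg₂⟩ := Subgroup.mem_inf.1 hg
    rw [Representation.mem_stabilizerSubgroup] at hg₁ ⊢
    rw [MonoidHom.mem_ker] at hg₂
    refine Subtype.ext (funext fun x => ?_)
    rw [Representation.indFun_apply_apply]
    show (((θ (x * g))⁻¹ : kˣ) : k) • F.toFun (x * g) = (((θ x)⁻¹ : kˣ) : k) • F.toFun x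
    have hx : F.toFun (x * g) = F.toFun x := by
      have := congrArg (fun F' : Representation.SmoothInd H (σ.twist (θ.comp H.subtype)) => F'.toFun x) hg₁
      simpa only [Representation.toFun_smoothIndRep_apply] using this
    rw [map_mul, hg₂, mul_one, hx]
  choose Ψ' hΨ' using hback
  have hΦΨ : ∀ F, Φ (Ψ' F) = F := fun F =>
    Representation.SmoothInd.ext (funext fun g => by
      rw [hΦ, hΨ', smul_smul, Units.mul_inv, one_smul])
  have hΨΦ : ∀ f, Ψ' (Φ f) = f := fun f =>
    Representation.SmoothInd.ext (funext fun g => by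
      rw [hΨ', hΦ, smul_smul, Units.inv_mul, one_smul])
  refine ⟨{ toFun := Φ, map_add' := ?_, map_smul' := ?_, invFun := Ψ', left_inv := hΨΦ, right_inv := hΦΨ },
    fun f g => hΦ f g, fun g₀ f => ?_⟩
  · intro f₁ f₂
    exact Representation.SmoothInd.ext (funext fun g => by
      rw [hΦ, Representation.SmoothInd.toFun_add, Representation.SmoothInd.toFun_add, Pi.add_apply, Pi.add_apply,
        hΦ, hΦ, smul_add])
  · intro c f
    exact Representation.SmoothInd.ext (funext fun g => by
      rw [hΦ, Representation.SmoothInd.toFun_smul, Representation.SmoothInd.toFun_smul, Pi.smul_apply, Pi.smul_apply,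
        hΦ, RingHom.id_apply, smul_comm])
  · refine Representation.SmoothInd.ext (funext fun x => ?_)
    show (Φ (((θ g₀ : kˣ) : k) • Representation.smoothIndRep H σ g₀ f)).toFun x =
      (Representation.smoothIndRep H (σ.twist (θ.comp H.subtype)) g₀ (Φ f)).toFun x
    rw [hΦ, Representation.toFun_smoothIndRep_apply, hΦ, Representation.SmoothInd.toFun_smul, Pi.smul_apply,
      Representation.toFun_smoothIndRep_apply, map_mul, Units.val_mul, mul_smul, smul_comm]

/-- **`θ ⊗ Ind_H^G σ ≅ Ind_H^G (σ ⊗ θ|_H)`** (over `ℂ`, as `Liu2021.AreIsomorphicRep`; the twist is `SeesawScalar.twist θ`,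
`g ↦ θ(g) • Ind σ (g)`). [cite: BernsteinZelevinskyASENS1977, 1.9] -/
theorem areIsomorphicRep_twist_smoothIndRep {G W : Type*} [Group G] [TopologicalSpace G] [IsTopologicalGroup G]
    [AddCommGroup W] [Module ℂ W] (H : Subgroup G) (σ : Representation ℂ H W) (θ : G →* ℂˣ)
    (hθ : IsOpen ((θ.ker : Subgroup G) : Set G)) :
    Liu2021.AreIsomorphicRep (RepresentationTheory.SeesawScalar.twist θ (Representation.smoothIndRep H σ))
      (Representation.smoothIndRep H (σ.twist (θ.comp H.subtype))) := by
  obtain ⟨e, -, he⟩ := SmoothInd.exists_linearEquiv_twist H σ θ hθ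
  exact ⟨e, fun g f => by rw [RepresentationTheory.SeesawScalar.twist_apply]; exact he g f⟩

end Twist

/-! ### Characters of `GL_N(K)` through `det` -/

section DetChar

variable {K : Type*} [Field K] {N : ℕ}

/-- **A character of `GL_N(K)` is `θ₀ ∘ det`, with `θ₀` unitary resp. smooth when `θ` is**: for `N ≥ 1` and `K ≠ 𝔽₂` every
`θ : GL_N(K) → ℂˣ` factors uniquely as `θ₀ ∘ det` (`GLAbelianization.existsUnique_eq_comp_det`); `θ₀(t) = θ(diag(t,1,…,1))`, so
`|θ₀| = 1` if `|θ| = 1`, and `ker θ₀` is open if `ker θ` is (for a topological field `K`). [cite: Zelevinsky1980, §1.1] -/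
theorem exists_eq_comp_det_of_character [TopologicalSpace K] [IsTopologicalRing K] (hN : 1 ≤ N) (hK : ∃ a : K, a ≠ 0 ∧ a ≠ 1)
    (θ : GL (Fin N) K →* ℂˣ) :
    ∃ θ₀ : Kˣ →* ℂˣ, θ = θ₀.comp Matrix.GeneralLinearGroup.det ∧
      ((∀ g, ‖((θ g : ℂˣ) : ℂ)‖ = 1) → ∀ t, ‖((θ₀ t : ℂˣ) : ℂ)‖ = 1) ∧
      (IsOpen ((θ.ker : Subgroup (GL (Fin N) K)) : Set (GL (Fin N) K)) → IsOpen ((θ₀.ker : Subgroup Kˣ) : Set Kˣ)) := by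
  haveI : Nonempty (Fin N) := ⟨⟨0, hN⟩⟩
  obtain ⟨θ₀, hθ₀, -⟩ := Literature.LinearAlgebra.Matrix.GLAbelianization.existsUnique_eq_comp_det hK θ
  -- the section `t ↦ diag(t, 1, …, 1)` of `det`
  have hsec : ∀ t : Kˣ, Matrix.GeneralLinearGroup.det (diagGL (Fin N) (Function.update 1 (⟨0, hN⟩ : Fin N) t)) = t := by
    intro t
    ext
    rw [Matrix.GeneralLinearGroup.val_det_apply, val_diagGL, det_diagonal, ← Units.coe_prod,
      Fintype.prod_eq_single (⟨0, hN⟩ : Fin N) (fun i hi => by rw [Function.update_of_ne hi, Pi.one_apply]),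
      Function.update_self]
  have hθ₀t : ∀ t : Kˣ, θ₀ t = θ (diagGL (Fin N) (Function.update 1 (⟨0, hN⟩ : Fin N) t)) := fun t => by
    rw [hθ₀, MonoidHom.comp_apply, hsec]
  refine ⟨θ₀, hθ₀, fun hu t => by rw [hθ₀t]; exact hu _, fun ho => ?_⟩
  have hpre : ((θ₀.ker : Subgroup Kˣ) : Set Kˣ) =
      (fun t : Kˣ => diagGL (Fin N) (Function.update 1 (⟨0, hN⟩ : Fin N) t)) ⁻¹'
        ((θ.ker : Subgroup (GL (Fin N) K)) : Set (GL (Fin N) K)) := by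
    ext t
    rw [SetLike.mem_coe, MonoidHom.mem_ker, Set.mem_preimage, SetLike.mem_coe, MonoidHom.mem_ker, hθ₀t]
  rw [hpre]
  exact ho.preimage (continuous_diagGL.comp (continuous_const.update _ continuous_id))

end DetChar

end Literature.NumberTheory.Automorphic

/-! ### `(θ₀∘det) ⊗ ((ν∘det) × χ′) ≅ ((νθ₀)∘det) × (χ′θ₀)` -/

namespace Literature.NumberTheory.Automorphic.Zelevinsky1980

open Literature.NumberTheory.Automorphic

variable (F : Type*) [Field F] [ValuativeRel F] [TopologicalSpace F] [IsNonarchimedeanLocalField F] (N : ℕ)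
  (ν χ' θ₀ : Fˣ →* ℂˣ)

omit [ValuativeRel F] [TopologicalSpace F] [IsNonarchimedeanLocalField F] in
/-- `det p = det A · λ` on `Q_{N-1,1}` (block upper triangular; `Matrix.BlockTriangular.det_fintype`), read through the Levi
projection: `det p = ∏_a det (proj p)_a = det (proj p)_false · det (proj p)_true`. [cite: Zelevinsky1980, §1.1, p. 170] -/
theorem det_eq_det_leviProjection_false_mul_true (p : ↥(standardParabolicGL F (lastBlockLabel N))) :
    Matrix.GeneralLinearGroup.det (p : GL (Fin N) F) =
      Matrix.GeneralLinearGroup.det (leviProjection F (lastBlockLabel N) p false) *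
        Matrix.GeneralLinearGroup.det (leviProjection F (lastBlockLabel N) p true) := by
  ext
  rw [Units.val_mul, Matrix.GeneralLinearGroup.val_det_apply, Matrix.GeneralLinearGroup.val_det_apply,
    Matrix.GeneralLinearGroup.val_det_apply, (blockTriangular_of_mem p).det_fintype, Fintype.prod_bool,
    coe_leviProjection_apply, coe_leviProjection_apply, mul_comm]

/-- **The inducing datum of `((νθ₀)∘det) × (χ′θ₀)` is `θ₀(det p)` times that of `(ν∘det) × χ′`.** [cite: Zelevinsky1980, §1.1 and §3.2] -/
theorem detCharDatum_mul_det [LocallyCompactSpace (standardParabolicGL F (lastBlockLabel N))]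
    (p : ↥(standardParabolicGL F (lastBlockLabel N))) (z : ℂ) :
    Representation.twist (((Representation.trivial ℂ (Π a : Bool, GL {i : Fin N // lastBlockLabel N i = a} F) ℂ).twist
        (maxParabolicLeviChar F N (ν * θ₀) (χ' * θ₀))).comp (leviProjection F (lastBlockLabel N)))
      (rootDeltaChar (standardParabolicGL F (lastBlockLabel N))) p z =
      ((θ₀ (Matrix.GeneralLinearGroup.det (p : GL (Fin N) F)) : ℂˣ) : ℂ) *
        Representation.twist (((Representation.trivial ℂ (Π a : Bool, GL {i : Fin N // lastBlockLabel N i = a} F) ℂ).twist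
          (maxParabolicLeviChar F N ν χ')).comp (leviProjection F (lastBlockLabel N)))
          (rootDeltaChar (standardParabolicGL F (lastBlockLabel N))) p z := by
  rw [detCharDatum_apply, detCharDatum_apply, maxParabolicLeviChar_apply, maxParabolicLeviChar_apply,
    det_eq_det_leviProjection_false_mul_true, MonoidHom.mul_apply, MonoidHom.mul_apply, map_mul θ₀]
  simp only [Units.val_mul]
  ring

/-- The inducing datum of `((νθ₀)∘det) × (χ′θ₀)` IS the twist of that of `(ν∘det) × χ′` by `(θ₀ ∘ det)|_P` (equality of
representations of `Q_{N-1,1}`). [cite: Zelevinsky1980, §1.1 and §3.2] -/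
theorem detCharDatum_mul_eq_twist [LocallyCompactSpace (standardParabolicGL F (lastBlockLabel N))] :
    Representation.twist (((Representation.trivial ℂ (Π a : Bool, GL {i : Fin N // lastBlockLabel N i = a} F) ℂ).twist
        (maxParabolicLeviChar F N (ν * θ₀) (χ' * θ₀))).comp (leviProjection F (lastBlockLabel N)))
      (rootDeltaChar (standardParabolicGL F (lastBlockLabel N))) =
      (Representation.twist (((Representation.trivial ℂ (Π a : Bool, GL {i : Fin N // lastBlockLabel N i = a} F) ℂ).twist
          (maxParabolicLeviChar F N ν χ')).comp (leviProjection F (lastBlockLabel N)))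
          (rootDeltaChar (standardParabolicGL F (lastBlockLabel N)))).twist
        ((θ₀.comp Matrix.GeneralLinearGroup.det).comp (standardParabolicGL F (lastBlockLabel N)).subtype) := by
  refine MonoidHom.ext fun p => LinearMap.ext fun z => ?_
  conv_rhs => rw [Representation.twist_apply, MonoidHom.comp_apply, MonoidHom.comp_apply, Subgroup.coe_subtype, smul_eq_mul]
  rw [detCharDatum_mul_det]

/-- **`(θ₀∘det) ⊗ ((ν∘det) × χ′) ≅ ((νθ₀)∘det) × (χ′θ₀)`** as representations of `GL_N(F)` (`F` a non-archimedean local field,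
`θ₀ : Fˣ → ℂˣ` with OPEN kernel; the twist is `SeesawScalar.twist (θ₀ ∘ det)`): a `χ(det)`-twist of the normalised parabolic
induction of a character is the induction of the twisted character. [cite: Zelevinsky1980, Prop. 1.1 and §3.2] -/
theorem areIsomorphicRep_twist_det_parabolicIndGL_detChar [LocallyCompactSpace (standardParabolicGL F (lastBlockLabel N))]
    (hθ₀ : IsOpen ((θ₀.ker : Subgroup Fˣ) : Set Fˣ)) :
    Liu2021.AreIsomorphicRep
      (RepresentationTheory.SeesawScalar.twist (θ₀.comp Matrix.GeneralLinearGroup.det)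
        (Representation.parabolicIndGL F (lastBlockLabel N)
          ((Representation.trivial ℂ (Π a : Bool, GL {i : Fin N // lastBlockLabel N i = a} F) ℂ).twist
            (maxParabolicLeviChar F N ν χ'))))
      (Representation.parabolicIndGL F (lastBlockLabel N)
        ((Representation.trivial ℂ (Π a : Bool, GL {i : Fin N // lastBlockLabel N i = a} F) ℂ).twist
          (maxParabolicLeviChar F N (ν * θ₀) (χ' * θ₀)))) := by
  have hθ : IsOpen ((((θ₀.comp Matrix.GeneralLinearGroup.det) : GL (Fin N) F →* ℂˣ).ker : Subgroup (GL (Fin N) F)) :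
      Set (GL (Fin N) F)) := by
    have hpre : ((((θ₀.comp Matrix.GeneralLinearGroup.det) : GL (Fin N) F →* ℂˣ).ker : Subgroup (GL (Fin N) F)) :
        Set (GL (Fin N) F)) = Matrix.GeneralLinearGroup.det ⁻¹' ((θ₀.ker : Subgroup Fˣ) : Set Fˣ) := by
      ext g
      rw [SetLike.mem_coe, MonoidHom.mem_ker, Set.mem_preimage, SetLike.mem_coe, MonoidHom.mem_ker, MonoidHom.comp_apply]
    rw [hpre]
    exact hθ₀.preimage Matrix.GeneralLinearGroup.continuous_det
  have h := areIsomorphicRep_twist_smoothIndRep (standardParabolicGL F (lastBlockLabel N))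
    (Representation.twist (((Representation.trivial ℂ (Π a : Bool, GL {i : Fin N // lastBlockLabel N i = a} F) ℂ).twist
      (maxParabolicLeviChar F N ν χ')).comp (leviProjection F (lastBlockLabel N)))
      (rootDeltaChar (standardParabolicGL F (lastBlockLabel N)))) (θ₀.comp Matrix.GeneralLinearGroup.det) hθ
  rw [← detCharDatum_mul_eq_twist] at h
  exact h

end Literature.NumberTheory.Automorphic.Zelevinsky1980

end
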